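import Summits.CriticalPhenomena.PercolationContinuityZ3.Theorems.PercNearOneGluingNoHeavyQuantFarHairyCycleSun
import Mathlib.Data.Real.Basic
import HarnessLib

/-!
# FAR beyond trees: the SUN-LAW VOCABULARY — the law-level ("two-chain") functional of the sun graph `C_{K+1}` and the
# elementary row `HairyCycle.SunFAR K j` (definitions only)

builds on p205010 (kernel theorem, internal audit signed; external expert review pending)

Support file (`--supports stmt-CriticalPhenomena-4575`), seat `prim-cert-1` (gen 20); QUANT lane rung R8, front "FAR beyond trees" (lead g22);
this is the interface asked for by prim-quant-p1 g16 (memo `quant/prim-quant-p1-g16/FOR-LEAD-TWOCHAIN-A.md` §4(f), §10 item 3: "the two-chain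
functional + `TwoChainMCA : Prop` + the bridge sun-FARp ⟸ …").  Definitions only (reviewed); the dictionary theorems are in `…QuantFarSunAtoms` /
`…QuantFarSunLaw`, the bridge to `Quant.FarRelayRow` on every hairy cycle in `…QuantFarSunRow`.

THE SUN GRAPH `sunEs K` (`…QuantFarHairyCycleSun`): cycle `c_0 = o, c_1, …, c_K, c_0` (cycle edge `e_m = s(c_m, c_{(m+1) mod (K+1)})`, `m ≤ K`)
with one pendant hair `s(c_{k+1}, t_k)` per non-observer vertex, `k < K`.  LAW-LEVEL COORDINATES: cycle-edge weights `g : ℕ → ℝ` (`g m`, `m ≤ K`)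
and hair weights `h : ℕ → ℝ` (`h k`, `k < K`); for a weight function `q` on the pairs of `Fin (2K+1)` they are read by `sunG K q`, `sunH K q`.

* `arcA g i = ∏_{m<i} g m` — the clockwise arc `o → c_i` is open; `arcB K g i = ∏_{i ≤ m ≤ K} g m` — the counter-clockwise arc `c_i → o` is open;
  `arcA g (K+1)` = every cycle edge open.  Marginal of tip `k`: `h k · (arcA g (k+1) + arcB K g (k+1) − arcA g (K+1))` (`sunMarg`).
* `hairW K h Q = ∏_{k<K} (h k if k ∈ Q else 1 − h k)` — the law of the set `Q` of open hairs.
* `arcIx K = {(l, l') : l ≤ l' ≤ K} ∪ {(K+1, K+1)}` — the almost-sure "closed extent" of the cycle: `l` / `l'` = first / last CLOSED cycle edge,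
  `(K+1, K+1)` = no closed cycle edge;  `arcW K g l l' = ∏_{m ≤ K, ¬(l<m<l')} (g m if m < l ∨ l' < m else 1 − g m)` — its law (edges before `l` and
  after `l'` open, `e_l`, `e_{l'}` closed, edges strictly between free);  `cov K l l' = {k < K : k < l ∨ l' ≤ k}` — the hair indices whose position
  `k+1` is then joined to `o` (clockwise iff `k+1 ≤ l`, counter-clockwise iff `k+1 > l'`).
* `sunLaw K g h Φ = Σ_{Q ⊆ [0,K)} Σ_{(l,l') ∈ arcIx K} hairW Q · arcW l l' · 𝟙[Φ(Q ∩ cov l l')]` — **the law-level functional**: for `q` vanishing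
  off the sun graph it IS `P_q(Φ{k < K : o ↔ t_k})` (`HairyCycle.real_sun_reached_eq`, `…QuantFarSunLaw`).
* `SunFAR K j` — **FAR at layer `j` on the sun graph with `K` hairs, LAW LEVEL** (pure real algebra, no measure): for all `g, h` with values in
  `[0,1]`, `2j < Σ_{k<K} marg_k` and `1 − marg_k ≤ t` (`k < K`) imply `sunLaw K g h (#· ≤ j) ≤ t`.  By `HairyCycle.farRelayRow_hairyCycle_of_sunFAR`
  (`…QuantFarSunRow`) it gives the body of `Quant.FarRelayRow` at layer `j` on EVERY hairy cycle with `K` pendant relays (all lengths, all weights).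
  Known: `K ≤ 7`, every `j` (sun certificates, gen 18); OPEN for `K ≥ 8` — the all-`K` target of the layer-one programme (p1 g15/g16: two-arc lemmas).
* almost-sure coordinates of a configuration `ω` of the sun graph: `hairSet` (open hairs), `closedSet` (closed cycle edges), `firstClosed` / `lastClosed` (first / last
  closed cycle edge, `K+1` if none) and the `atom K Q l l'` (cylinder event "hairs open exactly on `Q`, closed extent `(l, l')`").
[cite: Grimmett1999, §1.3 p. 10; §2.2] (product measure; events determined by finitely many coordinates); [cite: KozmaNitzan2024, Conjecture 3 (p. 15)]
(the gluing rows this serves); the vocabulary is elementary bookkeeping [this work].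
-/

noncomputable section

namespace Summit.CriticalPhenomena.PercolationContinuityZ3.Theorems.HairyCycle

open Finset

/-! ## Law-level coordinates and the functional -/

/-- Clockwise arc weight `α_i = ∏_{m<i} g m` (cycle edges `e_0, …, e_{i−1}` open). [this work] -/
def arcA (g : ℕ → ℝ) (i : ℕ) : ℝ := ∏ m ∈ range i, g m

/-- Counter-clockwise arc weight `β_i = ∏_{i ≤ m ≤ K} g m` (cycle edges `e_i, …, e_K` open). [this work] -/
def arcB (K : ℕ) (g : ℕ → ℝ) (i : ℕ) : ℝ := ∏ m ∈ Ico i (K + 1), g m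

/-- Marginal of tip `k`: hair open and (clockwise or counter-clockwise arc open) — `h k · (α_{k+1} + β_{k+1} − α_{K+1})`. [this work] -/
def sunMarg (K : ℕ) (g h : ℕ → ℝ) (k : ℕ) : ℝ := h k * (arcA g (k + 1) + arcB K g (k + 1) - arcA g (K + 1))

/-- Law of the open-hair set: `hairW Q = ∏_{k<K} (h k if k ∈ Q else 1 − h k)`. [this work] -/
def hairW (K : ℕ) (h : ℕ → ℝ) (Q : Finset ℕ) : ℝ := ∏ k ∈ range K, if k ∈ Q then h k else 1 - h k

/-- Law of the closed extent `(l, l')`: edges `m < l` and `m > l'` open, `e_l`, `e_{l'}` closed (when `≤ K`), edges strictly between free: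
`arcW l l' = ∏_{m ≤ K, ¬(l<m<l')} (g m if m < l ∨ l' < m else 1 − g m)`. [this work] -/
def arcW (K : ℕ) (g : ℕ → ℝ) (l l' : ℕ) : ℝ :=
  ∏ m ∈ (range (K + 1)).filter (fun m => ¬ (l < m ∧ m < l')), if m < l ∨ l' < m then g m else 1 - g m

/-- The closed-extent index set: `l ≤ l' ≤ K`, and `(K+1, K+1)` for "no closed cycle edge". [this work] -/
def arcIx (K : ℕ) : Finset (ℕ × ℕ) :=
  (range (K + 2) ×ˢ range (K + 2)).filter fun p => (p.1 ≤ p.2 ∧ p.2 ≤ K) ∨ (p.1 = K + 1 ∧ p.2 = K + 1)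

/-- Hair indices whose position is joined to `o` for the closed extent `(l, l')`: `k < l` (clockwise) or `l' ≤ k` (counter-clockwise). [this work] -/
def cov (K : ℕ) (l l' : ℕ) : Finset ℕ := (range K).filter fun k => k < l ∨ l' ≤ k

open scoped Classical in
/-- **The law-level functional of the sun graph**: `sunLaw K g h Φ = Σ_{Q ⊆ [0,K)} Σ_{(l,l') ∈ arcIx K} hairW Q · arcW l l' · 𝟙[Φ(Q ∩ cov l l')]`
— the probability that the set of reached hair indices satisfies `Φ` (`HairyCycle.real_sun_reached_eq`). [this work] -/
def sunLaw (K : ℕ) (g h : ℕ → ℝ) (Φ : Finset ℕ → Prop) : ℝ :=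
  ∑ Q ∈ (range K).powerset, ∑ p ∈ arcIx K, hairW K h Q * arcW K g p.1 p.2 * (if Φ (Q ∩ cov K p.1 p.2) then 1 else 0)

/-- **FAR at layer `j` on the sun graph with `K` hairs, law level** (the elementary form of `TwoCopy.FARp` on `sunEs K`, all weights):
for cycle-edge weights `g m ∈ [0,1]` (`m ≤ K`) and hair weights `h k ∈ [0,1]` (`k < K`), if `2j < Σ_{k<K} marg_k` and `1 − marg_k ≤ t` for
all `k < K` (`marg_k = sunMarg K g h k`), then `P(#reached ≤ j) = sunLaw K g h (#· ≤ j) ≤ t`.  Equivalent to the body of `Quant.FarRelayRow`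
at layer `j` on every hairy cycle with `K` pendant relays (`HairyCycle.farRelayRow_hairyCycle_of_sunFAR`); known for `K ≤ 7` (sun certificates),
OPEN for `K ≥ 8`. [this work] [status: open] -/
@[conjecture] def SunFAR (K j : ℕ) : Prop :=
  ∀ g h : ℕ → ℝ, (∀ m, m ≤ K → 0 ≤ g m ∧ g m ≤ 1) → (∀ k, k < K → 0 ≤ h k ∧ h k ≤ 1) →
    (2 * j : ℝ) < ∑ k ∈ range K, sunMarg K g h k →
    ∀ t : ℝ, (∀ k, k < K → 1 - sunMarg K g h k ≤ t) →
      sunLaw K g h (fun R => R.card ≤ j) ≤ t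

/-! ## Reading the coordinates off a weight function of the sun graph -/

/-- Cycle-edge weights `g m = q(e_m)` of a weight function on the pairs of `Fin (2K+1)`. [this work] -/
def sunG (K : ℕ) (q : Sym2 (Fin (2 * K + 1)) → unitInterval) (m : ℕ) : ℝ := q (cycE (K + 1) (sunCyc K) m)

/-- Hair weights `h k = q(s(c_{k+1}, t_k))`. [this work] -/
def sunH (K : ℕ) (q : Sym2 (Fin (2 * K + 1)) → unitInterval) (k : ℕ) : ℝ := q (hairE (sunCyc K) sunBase (sunTip K) k)

/-! ## Almost-sure coordinates of a configuration; atoms -/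

open scoped Classical in
/-- The set of open hairs of a configuration (by index `k < K`). [this work] -/
def hairSet (K : ℕ) (ω : Set (Sym2 (Fin (2 * K + 1)))) : Finset ℕ :=
  (range K).filter fun k => hairE (sunCyc K) sunBase (sunTip K) k ∈ ω

open scoped Classical in
/-- The set of closed cycle edges of a configuration (by index `m ≤ K`). [this work] -/
def closedSet (K : ℕ) (ω : Set (Sym2 (Fin (2 * K + 1)))) : Finset ℕ :=
  (range (K + 1)).filter fun m => cycE (K + 1) (sunCyc K) m ∉ ω

/-- The first closed cycle edge (`K+1` if none). [this work] -/
def firstClosed (K : ℕ) (ω : Set (Sym2 (Fin (2 * K + 1)))) : ℕ :=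
  if h : (closedSet K ω).Nonempty then (closedSet K ω).min' h else K + 1

/-- The last closed cycle edge (`K+1` if none). [this work] -/
def lastClosed (K : ℕ) (ω : Set (Sym2 (Fin (2 * K + 1)))) : ℕ :=
  if h : (closedSet K ω).Nonempty then (closedSet K ω).max' h else K + 1

/-- The ATOM of hair pattern `Q` and closed extent `(l, l')`: hairs open exactly on `Q`; every cycle edge `e_m` (`m ≤ K`) outside the open
interval `(l, l')` is open iff `m < l ∨ l' < m` (a cylinder event; the edges strictly between `l` and `l'` are free). [this work] -/
def atom (K : ℕ) (Q : Finset ℕ) (l l' : ℕ) : Set (Set (Sym2 (Fin (2 * K + 1)))) :=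
  {ω | (∀ k, k < K → (hairE (sunCyc K) sunBase (sunTip K) k ∈ ω ↔ k ∈ Q)) ∧
    ∀ m, m ≤ K → ¬ (l < m ∧ m < l') → (cycE (K + 1) (sunCyc K) m ∈ ω ↔ (m < l ∨ l' < m))}

/-! ## Two membership lemmas -/

variable {K : ℕ}

/-- Membership in the closed-extent index set. [this work] -/
theorem mem_arcIx {p : ℕ × ℕ} : p ∈ arcIx K ↔ (p.1 ≤ p.2 ∧ p.2 ≤ K) ∨ (p.1 = K + 1 ∧ p.2 = K + 1) := by
  unfold arcIx
  rw [Finset.mem_filter, Finset.mem_product, Finset.mem_range, Finset.mem_range]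
  constructor
  · exact fun h => h.2
  · intro h
    refine ⟨⟨?_, ?_⟩, h⟩ <;> omega

/-- Membership in `cov`. [this work] -/
theorem mem_cov {l l' k : ℕ} : k ∈ cov K l l' ↔ k < K ∧ (k < l ∨ l' ≤ k) := by
  unfold cov
  rw [Finset.mem_filter, Finset.mem_range]

end Summit.CriticalPhenomena.PercolationContinuityZ3.Theorems.HairyCycle

end
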